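import Summits.CriticalPhenomena.PercolationContinuityZ3.Theorems.PercNearOneGluingNoHeavyQuantMonoHubTwoBlocks
import HarnessLib

/-!
# QUANT lane R8, FAR on trees: FAR at every layer for 'hub + leaves + TWO jointly-light root blocks of arbitrary gates',
# average leaf gate

builds on p205010 (kernel theorem, internal audit signed; external expert review pending)

Support file (`--supports stmt-CriticalPhenomena-4575`), QUANT lane typer seat prim-quant-stmt (gen 13); memo
`run/shared/lean/prim/quant/prim-quant-stmt-g13/MONO-RELAXATION.md` §4.  Theorems only; no definitions, no sorries, standard axioms.

* `Quant.farTree_hubTwoLightBlocks_avgGate` — setting of `Quant.farTree_hubBlocks_of_profile` (observer `o`; hub `h` with leaf relays `L`;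
  root block vertices `K` with gate-`1` tails `B b`; relays `A = L ∪ ⋃_{b∈K}({b} ∪ B b)`) with `K = {b₁, b₂}`, `b₁ ≠ b₂`, block sizes
  `|B b₁| + 1 ≤ |B b₂| + 1` and `(|B b₁|+1) + (|B b₂|+1) ≤ j` (jointly light), block gates `q b₁`, `q b₂` ARBITRARY.  If
  `2j < q h·Σ_{ℓ∈L} q ℓ + Σ_{b∈K} q b·(|B b|+1)` (`= Σ_{a∈A} P(a reached)`), `1 − q b ≤ t` on `K` and `1 − q h·(Σ_L q)/|L| ≤ t` (AVERAGE leaf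
  gate), then `P(#{a ∈ A counted} ≤ j) ≤ t`.  Via `Quant.hubBlocksProfileIneq_mono_pair` (the profile conjecture for two jointly-light blocks and
  monotone hub laws), `Quant.pb_pmf_mono_succ`, `Quant.pb_mean`, `Quant.pb_levels_sum_one`, `Quant.farTree_hubBlocks_of_profile`.
  First FAR row in the kernel for root blocks of two DIFFERENT intermediate gates with the true mean (cf. `Quant.farTree_hubBlocks_commonGate`).
[cite: KozmaNitzan2024, Conjecture 3 (p. 15)] (the gluing rows served); the inequality is [this work].
-/

noncomputable section

namespace Summit.CriticalPhenomena.PercolationContinuityZ3.Theorems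

namespace Quant

open Finset MeasureTheory
open Literature.Probability.LatticeModels
open Literature.Probability.Percolation
open scoped Classical

variable {n : ℕ}

/-- **FAR at every layer for 'hub (any gate) + leaf relays (any gates) + TWO jointly-light root blocks (any two gates)', average leaf gate.**
See the module docstring. [this work] -/
theorem farTree_hubTwoLightBlocks_avgGate (q : Fin n → unitInterval) (o h b₁ b₂ : Fin n) (L K : Finset (Fin n))
    (B : Fin n → Finset (Fin n)) (depth : Fin n → ℕ) (par : Fin n → Fin n) (j : ℕ) (t : ℝ)
    (hKeq : K = {b₁, b₂}) (hne : b₁ ≠ b₂) (hsz : (B b₁).card ≤ (B b₂).card)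
    (hlight : ((B b₁).card + 1) + ((B b₂).card + 1) ≤ j)
    (hK : ∀ b ∈ K, par b = o ∧ depth b = 0)
    (hL : ∀ a ∈ L, par a = h ∧ depth a = 1) (hB : ∀ b ∈ K, ∀ a ∈ B b, par a = b ∧ depth a = 1)
    (hhL : h ∉ L) (hhK : h ∉ K) (hLK : Disjoint L K) (hLB : ∀ b ∈ K, Disjoint L (B b))
    (hKB : ∀ b ∈ K, ∀ b' ∈ K, b ∉ B b') (hBB : ∀ b ∈ K, ∀ b' ∈ K, b ≠ b' → Disjoint (B b) (B b'))
    (hqB : ∀ b ∈ K, ∀ a ∈ B b, q a = 1) (hL0 : L.Nonempty)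
    (hEN : (2 * j : ℝ) < (q h : ℝ) * ∑ a ∈ L, (q a : ℝ) + ∑ b ∈ K, (q b : ℝ) * (((B b).card : ℝ) + 1))
    (htK : ∀ b ∈ K, 1 - (q b : ℝ) ≤ t) (htL : 1 - (q h : ℝ) * ((∑ a ∈ L, (q a : ℝ)) / L.card) ≤ t) :
    (prodBernoulli q).real {ω' : Set (Fin n) |
      ((L ∪ K.biUnion fun b => insert b (B b)).filter
        fun a => a = o ∨ ∀ i, i ≤ depth a → par^[i] a ∈ ω').card ≤ j} ≤ t := by
  set μ := prodBernoulli q with hμ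
  set U : ℝ := ∑ a ∈ L, (q a : ℝ) with hU
  set G : ℝ := (q h : ℝ) with hG
  have hG1 : G ≤ 1 := (q h).2.2
  have hL0' : 0 < L.card := Finset.card_pos.2 hL0
  have hLc : (0 : ℝ) < L.card := by exact_mod_cast hL0'
  have hb₁K : b₁ ∈ K := by rw [hKeq]; simp
  have hb₂K : b₂ ∈ K := by rw [hKeq]; simp
  -- degenerate cases: `U = 0` or `q h = 0` give `t ≥ 1`
  have hU0 : 0 ≤ U := Finset.sum_nonneg fun a _ => (q a).2.1
  rcases eq_or_lt_of_le hU0 with hUz | hUpos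
  · have : 1 ≤ t := by rw [← hUz] at htL; simpa using htL
    exact measureReal_le_one.trans this
  rcases eq_or_lt_of_le (q h).2.1 with hG0 | hGpos
  · have hG0' : G = 0 := by rw [hG]; exact hG0.symm
    have : 1 ≤ t := by rw [hG0', zero_mul, sub_zero] at htL; exact htL
    exact measureReal_le_one.trans this
  have hGpos' : 0 < G := hGpos
  -- `τ := min(U/|L|, min(q b₁, q b₂)/G)`
  set g₀ : ℝ := min (q b₁ : ℝ) (q b₂ : ℝ) with hg₀
  set τ : ℝ := min (U / L.card) (g₀ / G) with hτdef
  have hτU : τ ≤ U / L.card := min_le_left _ _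
  have hτK : ∀ y ∈ K, G * τ ≤ (q y : ℝ) := by
    intro y hy
    have hg₀y : g₀ ≤ (q y : ℝ) := by
      rw [hKeq, Finset.mem_insert, Finset.mem_singleton] at hy
      rcases hy with rfl | rfl
      · exact min_le_left _ _
      · exact min_le_right _ _
    calc G * τ ≤ G * (g₀ / G) := mul_le_mul_of_nonneg_left (min_le_right _ _) hGpos'.le
      _ = g₀ := by field_simp
      _ ≤ (q y : ℝ) := hg₀y
  have hτt : 1 - G * τ ≤ t := by
    rcases le_total (U / L.card) (g₀ / G) with hc | hc
    · rw [hτdef, min_eq_left hc]; exact htL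
    · rw [hτdef, min_eq_right hc]
      have e : G * (g₀ / G) = g₀ := by field_simp
      rw [e]
      rcases le_total (q b₁ : ℝ) (q b₂ : ℝ) with h12 | h12
      · rw [hg₀, min_eq_left h12]; exact htK b₁ hb₁K
      · rw [hg₀, min_eq_right h12]; exact htK b₂ hb₂K
  -- the hub law `P(X = b)`, monotone below its mean `U`
  set P : ℕ → ℝ := fun b' => μ.real {ω : Set (Fin n) | (L.filter fun x => x ∈ ω).card = b'} with hPdef
  have hp0 : ∀ b', 0 ≤ P b' := fun b' => measureReal_nonneg
  have hsum : ∑ b' ∈ Finset.range (L.card + 1), P b' = 1 := pb_levels_sum_one q L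
  have hmean : ∑ b' ∈ Finset.range (L.card + 1), (b' : ℝ) * P b' = U := pb_mean q L
  have hmono : ∀ b' : ℕ, 1 ≤ b' → (b' : ℝ) ≤ U → P (b' - 1) ≤ P b' := by
    intro b' hb1 hbU
    have := pb_pmf_mono_succ q L (b' - 1) (by
      have : (((b' - 1 : ℕ) : ℝ) + 1) = b' := by rw [Nat.cast_sub hb1]; push_cast; ring
      rw [this]; exact hbU)
    have e : b' - 1 + 1 = b' := by omega
    rw [e] at this
    exact this
  -- the mean hypothesis in the conjecture's shape (for `K = {b₁, b₂}`)
  have hEN' : (2 * j : ℝ) < (∑ y ∈ ({b₁, b₂} : Finset (Fin n)), (((B y).card + 1 : ℕ) : ℝ) * (q y : ℝ)) + G * U := by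
    have e : ∑ y ∈ ({b₁, b₂} : Finset (Fin n)), (((B y).card + 1 : ℕ) : ℝ) * (q y : ℝ) =
        ∑ b ∈ K, (q b : ℝ) * (((B b).card : ℝ) + 1) := by
      rw [hKeq]
      refine Finset.sum_congr rfl fun b _ => ?_
      push_cast; ring
    rw [e, hG, hU]; linarith
  have hτK' : ∀ y ∈ ({b₁, b₂} : Finset (Fin n)), G * τ ≤ (q y : ℝ) := by rw [← hKeq]; exact hτK
  have hmain := hubBlocksProfileIneq_mono_pair q b₁ b₂ hne (fun b' => (B b').card + 1) (by simpa using hsz) L.card P U G τ j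
    (by simpa using hlight) hp0 hsum hmean hUpos hmono hGpos' hG1 hEN' hτU hτK'
  rw [← hKeq] at hmain
  have hbound := farTree_hubBlocks_of_profile q o h L K B depth par j τ hK hL hB hhL hhK hLK hLB hKB hBB hqB hGpos' hmain
  exact hbound.trans hτt

end Quant

end Summit.CriticalPhenomena.PercolationContinuityZ3.Theorems
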